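import Literature.Barriers.CriticalPhenomena.PlaquetteWalkHoleRootSevenAboveFrameTwo
import HarnessLib

/-!
# Barrier catalogue (SAWScalingLimit): the frame of the cost-`7` vertical-end parents above the root row, III — THE FRAME DATA («COLUMN LAW», F3)

`Z → ∞` limit model of the printed Yang–Baxter weights [GlazmanManolescu2019, §1, eq. (1)]; the «RECTANGLE COEFFICIENT» line of the venture lane «pcv-sawmu»
(b-engine-1 g27). With F1 (`ΩG.sIn_firstHit_eq_S_of_cost_seven_E_above`: `r` is entered from below and left westwards) and F2
(`ΩG.fst_eq_firstTurn_of_cost_seven_E_above`: `r` stands on the first turn `p₁ = (w.1 + k, w.2)`), ★★★ `ΩG.frame_of_cost_seven_E_above` reads off the data the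
phase computation needs, for a wound class-`B2a` walk of limit cost `7` at a rhombus `r` strictly above the root row with `w.1 ≤ r.1`, end side `E`, turning
first arc in `r`: (i) the first turn is `W → N` and lies strictly before the first hit; (ii) every other arc before the first hit is straight (the prefix is the
root-row run, the left turn at `p₁`, and the straight climb into `r`); (iii) EVERY DOUBLY VISITED PLAQUETTE IS `p₁`, and then its two arcs are `W → N` and
`S → E` (a `w₁` plaquette whose second arc is a right turn entered vertically). Proof: the `S`-chain of `r` ends at `p₁` (singly visited, no kiss anywhere: a kiss
off the root row has two outsider chain ends, a kiss on the root row east of `p₁` would need `p₁` to use `E`) or at the bottom row through a doubly visited `p₁`;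
in the latter case the last eastward crossing of the column of `r` (`YBWalk.exists_last_cross`) is `p₁`'s second arc `S → E` after the first hit, the arc into
`r`'s column before the first hit enters `p₁` from `W` (so it is the first turn), and a kiss east of `p₁` would sit between `p₁` and the root-row turn `τ`, where a
plaquette using `N` sends its `N`-chain to a top-row outsider and its `S`-chain to a late bottom arc (making the bottom end of `r`'s column a second outsider).
[GlazmanManolescu2019 §1 Fig. 1, eq. (1), Lemma 2.1, Remark 2.2; Glazman2015WeightedSAW Lemma 3.1 (proof, pp. 6–7); CourantRobbins1958 Ch. V App. §2]
-/

noncomputable section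

namespace Literature.Probability.RandomPlanarGeometry.SAW.YangBaxter

open Real
open Literature.Barriers.CriticalPhenomena.PlaquetteWalk

open private fc_fh fh_add_Mv three_le_Mv from Literature.Probability.RandomPlanarGeometry.YangBaxterSAWGeneralDomain

namespace ΩG

open private sIn_succ_of_sOut_N sIn_succ_of_sOut_S from Literature.Barriers.CriticalPhenomena.PlaquetteWalkHoleRootRowLaw
open private fc_sOut_pred_of_sIn_S fc_sOut_pred_of_sIn_N from Literature.Barriers.CriticalPhenomena.PlaquetteWalkStraightRuns

variable {D : Set Face} {w r : Face} {ω : ΩG D (w.side .W) r}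

set_option maxHeartbeats 400000 in -- one theorem, ≈ 1 000 tactic lines (200 000 does not suffice)
/-- ★★★ **THE FRAME DATA OF A COST-`7` PARENT ABOVE THE ROOT ROW** (end side `E`): for a wound class-`B2a` walk of limit cost `7` from the hole root `w.side W`
at a rhombus `r` strictly above the root row with `w.1 ≤ r.1`, ending on the `E` side of `r` with a turning first arc in `r`, whose arcs `0, …, k − 1` are straight
and whose arc `k` turns: the arc `k` is `W → N` and comes strictly before the first hit, every other arc before the first hit is straight, and any two different
arcs in one plaquette lie in `p₁ = (w.1 + k, w.2)` and are `W → N` and `S → E`. [cite: GlazmanManolescu2019, §1, Fig. 1 and eq. (1); Lemma 2.1; Remark 2.2]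
[cite: Glazman2015WeightedSAW, Lemma 3.1 (proof, pp. 6–7)] [cite: CourantRobbins1958, Ch. V Appendix §2 (the even–odd rule)] -/
theorem frame_of_cost_seven_E_above (hh : holeFaceW w ∉ D) (hr : RootedFace D (w.side .W) r) (h : ω.IsB2a)
    (hA : ω.AJ hr h (toC (midPt (w.side .W))) ≠ 0) (hc : cost (slotOfSide ω.1) ω.2.mids = 7) (hE : ω.1 = .E)
    (hNS : arcKind (ω.2.sIn ω.2.firstHitG) (ω.2.sOut ω.2.firstHitG) ≠ .straight) (habove : w.2 < r.2) (hcol : w.1 ≤ r.1)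
    {k : ℕ} (hk : k < ω.2.arcs.length) (hstrk : ∀ i < k, arcKind (ω.2.sIn i) (ω.2.sOut i) = .straight)
    (hturnk : arcKind (ω.2.sIn k) (ω.2.sOut k) ≠ .straight) :
    ω.2.sIn k = .W ∧ ω.2.sOut k = .N ∧ k < ω.2.firstHitG ∧
      (∀ i < ω.2.firstHitG, i ≠ k → arcKind (ω.2.sIn i) (ω.2.sOut i) = .straight) ∧
      (∀ i j : ℕ, i < ω.2.arcs.length → j < ω.2.arcs.length → ω.2.fc i = ω.2.fc j → i ≠ j →
        ω.2.fc i = (w.1 + k, w.2) ∧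
          ((ω.2.sIn i = .W ∧ ω.2.sOut i = .N ∧ ω.2.sIn j = .S ∧ ω.2.sOut j = .E) ∨
            (ω.2.sIn i = .S ∧ ω.2.sOut i = .E ∧ ω.2.sIn j = .W ∧ ω.2.sOut j = .N))) := by
  classical
  set n := ω.2.arcs.length with hn
  have hz : ω.1 = .E ∨ ω.1 = .W := Or.inl hE
  ---------------------------------------------------------------- counts: six isolated turns
  have hd : slotDeg (slotOfSide ω.1) = 0 := by rw [hE]; rfl
  have h6 : cfgCount ω.2.mids [.corner] + cfgCount ω.2.mids [.coCorner] = 6 := by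
    have hcost : cost (slotOfSide ω.1) ω.2.mids =
        cfgCount ω.2.mids [.corner] + cfgCount ω.2.mids [.coCorner] + (1 - slotDeg (slotOfSide ω.1)) := rfl
    rw [hcost, hd] at hc; omega
  let P : Face → Prop := fun f => f ∈ facesL ω.2.mids ∧ (kindsL ω.2.mids f = [.corner] ∨ kindsL ω.2.mids f = [.coCorner])
  have hPiso : ∀ k < n, (∀ l < n, ω.2.fc l = ω.2.fc k → l = k) → arcKind (ω.2.sIn k) (ω.2.sOut k) ≠ .straight → P (ω.2.fc k) :=
    fun k hk hsv hkind => isolated_turn hk hsv hkind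
  have hle6 : ∀ T : Finset Face, (∀ f ∈ T, P f) → T.card ≤ 6 := by
    intro T hT; have := YBWalk.card_le_cfgCount_add ω.2.mids T hT; omega
  have hPD : ∀ f s, ω.2.UsesSide f s → f ∈ D := by
    rintro f s ⟨i, hi, hfi, -⟩; rw [← hfi]; exact (YBWalk.arcFace_arcAt hi).2
  ---------------------------------------------------------------- basics
  have hF := ω.fh_lt h
  have hlen : 0 < n := by omega
  have h0w : ω.2.fc 0 = w := fc_zero_eq_root w hh ω.2 hlen
  have h0W : ω.2.sIn 0 = .W := YBWalk.sIn_zero_eq_W hh ω.2 hlen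
  have h0E : ω.2.sIn 0 ≠ .E := by rw [h0W]; decide
  have h0S : ω.2.sIn 0 ≠ .S := by rw [h0W]; decide
  have h0N : ω.2.sIn 0 ≠ .N := by rw [h0W]; decide
  obtain ⟨hzW, hfcZ⟩ : ω.2.sOut (n - 1) = .W ∧ ω.2.fc (n - 1) = (r.1 + 1, r.2) := by
    rcases last_of_vertical_end hr h hz with ⟨-, h1, h2⟩ | ⟨hW, -, -⟩
    · exact ⟨h1, h2⟩
    · rw [hE] at hW; exact absurd hW (by decide)
  have hzE' : ω.2.sOut (n - 1) ≠ .E := by rw [hzW]; decide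
  have hzS' : ω.2.sOut (n - 1) ≠ .S := by rw [hzW]; decide
  have hzN' : ω.2.sOut (n - 1) ≠ .N := by rw [hzW]; decide
  have hfne3 : ω.2.firstHitG + 3 ≤ n := by have := three_le_Mv hr h; have := fh_add_Mv h; unfold ΩG.Mv at *; omega
  have hfcF := (fc_fh ω hr h).1
  have hsvr : ∀ l < n, ω.2.fc l = ω.2.fc ω.2.firstHitG → l = ω.2.firstHitG := fun l hl e => eq_firstHitG_of_fc_eq hr h hl e
  have hPr : P r := by rw [← hfcF]; exact hPiso _ hF hsvr hNS
  have hrside : ∀ s, ω.2.UsesSide r s → r.side s ≠ r.side ω.1 := by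
    rintro s ⟨l, hl, hfl, hs⟩ e
    have hl' := hsvr l hl (hfl.trans hfcF.symm)
    obtain ⟨hin, hout⟩ := ω.2.side_sIn_eq_nth hl
    rw [hfl] at hin hout
    rw [← ω.2.nth_length] at e
    rcases hs with hs | hs
    · rw [hs] at hin; have := ω.2.nth_inj (show l ≤ n by omega) le_rfl (hin.symm.trans e).symm.symm; omega
    · rw [hs] at hout; have := ω.2.nth_inj (show l + 1 ≤ n by omega) le_rfl (hout.symm.trans e).symm.symm; omega
  have hrE : ¬ω.2.UsesSide r .E := fun hu => hrside .E hu (by rw [hE])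
  have hneF := ω.2.sIn_ne_sOut hF
  obtain ⟨X, hXw, hX, -⟩ := exists_left_entry_turn hh hr h hA
  obtain ⟨X', -, hX', -⟩ := exists_right_entry_turn hh hr h
  -- the first turn comes at or before the first hit, and strictly before it (`p₁` lies in the root row, `r` above it)
  have hkF : k ≤ ω.2.firstHitG := by
    by_contra hlt
    exact hNS (hstrk _ (by omega))
  -- a turning arc uses a horizontal side and a vertical side
  have hHor : ∀ i < n, arcKind (ω.2.sIn i) (ω.2.sOut i) ≠ .straight → ω.2.UsesSide (ω.2.fc i) .W ∨ ω.2.UsesSide (ω.2.fc i) .E := by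
    intro i hi hk'
    have hne := ω.2.sIn_ne_sOut hi
    have key : (ω.2.sIn i = .W ∨ ω.2.sOut i = .W) ∨ (ω.2.sIn i = .E ∨ ω.2.sOut i = .E) := by
      revert hne hk'; cases ω.2.sIn i <;> cases ω.2.sOut i <;> decide
    rcases key with hW | hEx
    · exact Or.inl ⟨i, hi, rfl, hW⟩
    · exact Or.inr ⟨i, hi, rfl, hEx⟩
  ---------------------------------------------------------------- the top row is `r.2`; the first arc uses `S` and `W`
  have htop := top_row_of_cost_seven_vert_above hh hr h hA hc hz hNS habove
  have hNtop := forall_top_ne_N hh hr h htop habove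
  have hupN : ∀ f : Face, f.2 = r.2 → ¬ω.2.UsesSide f .N := by
    rintro f hf ⟨i, hi, hfi, hs | hs⟩
    · exact (hNtop i hi (by rw [hfi, hf])).1 hs
    · exact (hNtop i hi (by rw [hfi, hf])).2 hs
  have hsvTop : ∀ i, i < n → (ω.2.fc i).2 = r.2 → ∀ l < n, ω.2.fc l = ω.2.fc i → l = i :=
    fun i hi hrw l hl e => (top_single_visit hh hr h htop habove hi hl hrw e.symm).symm
  ---------------------------------------------------------------- the bottom turns and the root-row turn `τ`
  obtain ⟨Y', hY'w, hY', j₀, j₁, -, hj₀2, hrow₀', hN₀', hWE₀', hj₀₁, hj₁, hrow₁', hmax₁, halt'⟩ := bottom_exit_or_end hh hr h hA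
  obtain ⟨hN₁', hWE₁', -, hfne'⟩ : (ω.2.sOut j₁ = .N ∧ (ω.2.sIn j₁ = .W ∨ ω.2.sIn j₁ = .E) ∧ j₀ ≠ j₁ ∧ ω.2.fc j₀ ≠ ω.2.fc j₁) := by
    rcases halt' with hh' | ⟨-, -, hrY'⟩
    · exact hh'
    · exfalso; omega
  have hj₀ : j₀ < n := by omega
  have hsvB : ∀ k, k < n → (ω.2.fc k).2 = Y' → ∀ l < n, ω.2.fc l = ω.2.fc k → l = k :=
    fun k hk hrw l hl e => (bottom_single_visit hh hr h hY' (by omega) hk hl hrw e.symm).symm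
  have hbotS := forall_bottom_ne_S hh hr h hY' (by omega)
  have hPb₀ : P (ω.2.fc j₀) := hPiso j₀ hj₀ (hsvB j₀ hj₀ hrow₀') (by rw [hN₀']; exact YBWalk.arcKind_ne_straight_of_S_WE (Or.inr rfl) hWE₀')
  have hPb₁ : P (ω.2.fc j₁) := hPiso j₁ hj₁ (hsvB j₁ hj₁ hrow₁') (by rw [hN₁']; exact YBWalk.arcKind_ne_straight_of_WE_S hWE₁' (Or.inr rfl))
  -- the first turn `p₁ = (w.1 + k, w.2)`
  have hk₁ : k < n := hk
  have hstr := hstrk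
  obtain ⟨hrun, hrunE⟩ := ω.2.initial_run hh hk₁ hstr
  obtain ⟨hfk, hWk⟩ := hrun k le_rfl
  have hp₁W : ω.2.UsesSide (w.1 + k, w.2) .W := ⟨k, hk₁, hfk, Or.inl hWk⟩
  have hkEo : ω.2.sOut k ≠ .E := by
    intro e; apply hturnk; rw [hWk, e]; decide
  have hkNS : ω.2.sOut k = .N ∨ ω.2.sOut k = .S := by
    have hne := ω.2.sIn_ne_sOut hk₁
    rw [hWk] at hne
    revert hkEo hne; cases ω.2.sOut k <;> decide
  have hkltF : k < ω.2.firstHitG := by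
    rcases lt_or_eq_of_le hkF with hlt | heq
    · exact hlt
    · exfalso
      have e : (((w.1 : ℤ) + k, w.2) : Face) = r := by rw [← hfk, heq, hfcF]
      have := congrArg Prod.snd e; simp only at this; omega
  obtain ⟨τ1, hPτ, hτ1, hτW, hτnE, hτalt⟩ : ∃ τ1 : ℤ, P (τ1, w.2) ∧ w.1 + k ≤ τ1 ∧ ω.2.UsesSide (τ1, w.2) .W ∧ ¬ω.2.UsesSide (τ1, w.2) .E ∧
      ((τ1 = w.1 + k ∧ ¬ω.2.UsesSide (w.1 + k, w.2) .E) ∨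
        (w.1 + k < τ1 ∧ ω.2.UsesSide (w.1 + k, w.2) .E ∧ (∀ m : ℕ, 1 ≤ m → (m : ℤ) ≤ τ1 - (w.1 + k) → ω.2.UsesSide (w.1 + k + m, w.2) .W) ∧
          ∀ m : ℕ, (m : ℤ) < τ1 - (w.1 + k) → ω.2.UsesSide (w.1 + k + m, w.2) .E)) := by
    by_cases hpE : ω.2.UsesSide (w.1 + k, w.2) .E
    · obtain ⟨M, hWall, hEall', hend⟩ := ω.2.chain_E hX' hpE
      rcases hend with ⟨hM1, hnot⟩ | ⟨-, hs0⟩ | ⟨hZ, -⟩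
      · obtain ⟨i', hi', hfc', hsv', -, -, -, hk'⟩ := ω.2.isolated_of_usesSide_not_opp (hWall M hM1 le_rfl) hnot
        refine ⟨w.1 + k + M, ?_, by omega, hWall M hM1 le_rfl, hnot,
          Or.inr ⟨by omega, hpE, fun m hm1 hm2 => hWall m hm1 (by omega), fun m hm => hEall' m (by omega)⟩⟩
        have := hPiso i' hi' hsv' hk'; rw [hfc'] at this; exact this
      · exact absurd hs0 h0E
      · rw [hfcZ] at hZ; have := congrArg Prod.snd hZ; simp only at this; omega
    · obtain ⟨i', hi', hfc', hsv', -, -, -, hk'⟩ := ω.2.isolated_of_usesSide_not_opp hp₁W hpE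
      refine ⟨w.1 + k, ?_, le_rfl, hp₁W, hpE, Or.inl ⟨rfl, hpE⟩⟩
      have := hPiso i' hi' hsv' hk'; rw [hfc'] at this; exact this
  -- `τ` is singly visited
  have hsvτ : ∀ i, i < n → ω.2.fc i = ((τ1 : ℤ), w.2) → ∀ l < n, ω.2.fc l = ((τ1 : ℤ), w.2) → l = i :=
    fun i hi hfi l hl hfl => ω.2.single_visit_of_not_usesSide hτnE hl hi hfl hfi
  ---------------------------------------------------------------- F1: `r` is entered from `S` and left through `W`; the west turn `t` of its top-row chain
  obtain ⟨hSin, hWout⟩ := sIn_firstHit_eq_S_of_cost_seven_E_above hh hr h hA hc hE hNS habove hcol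
  obtain ⟨M, hEall, hWall, hend⟩ := ω.2.chain_W hX ⟨_, hF, hfcF, Or.inr hWout⟩
  obtain ⟨hM1, hnotW⟩ : 1 ≤ M ∧ ¬ω.2.UsesSide (r.1 - M, r.2) .W := by
    rcases hend with hT | ⟨hA0, -⟩ | ⟨hZ, -⟩
    · exact hT
    · rw [h0w] at hA0; have := congrArg Prod.snd hA0; simp only at this; omega
    · rw [hfcZ] at hZ; have := congrArg Prod.fst hZ; simp only at this; omega
  obtain ⟨iT, hiT, hfcT, hsvT, hET, hninT, hnoutT, hkT⟩ := ω.2.isolated_of_usesSide_not_opp (hEall M hM1 le_rfl) hnotW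
  have hPt : P (r.1 - M, r.2) := by rw [← hfcT]; exact hPiso iT hiT hsvT hkT
  -- the straight cells between `t` and `r`; `t` is entered from `E` at index `firstHitG + M`
  have hcellsW : ∀ m : ℕ, 1 ≤ m → m ≤ M - 1 → ∀ i < n,
      ω.2.fc i = ((ω.2.fc ω.2.firstHitG).1 - m, (ω.2.fc ω.2.firstHitG).2) → arcKind (ω.2.sIn i) (ω.2.sOut i) = .straight := by
    intro m hm1 hmM i hi hfi
    rw [hfcF] at hfi
    exact ω.2.straight_of_usesSide_EW (hEall m hm1 (by omega)) (hWall m (by omega)) (hupN _ rfl) i hi hfi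
  have hfMn : ω.2.firstHitG + M < n := by
    by_contra hge
    push Not at hge
    obtain ⟨hfcL, -⟩ := ω.2.run_west_of_straight (j := ω.2.firstHitG) (M := n - 1 - ω.2.firstHitG) (by omega) hWout
      (fun m hm1 hmM i hi hfi => hcellsW m hm1 (by omega) i hi hfi) (n - 1 - ω.2.firstHitG) le_rfl
    rw [show ω.2.firstHitG + (n - 1 - ω.2.firstHitG) = n - 1 by omega, hfcZ, hfcF] at hfcL
    have := congrArg Prod.fst hfcL; simp only at this; omega
  have hrunW := ω.2.run_west_of_straight (j := ω.2.firstHitG) (M := M - 1) (by omega) hWout hcellsW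
  obtain ⟨hiTF, hinT⟩ : ω.2.firstHitG + M = iT ∧ ω.2.sIn iT = .E := by
    obtain ⟨hfcM1, houtM1⟩ := hrunW (M - 1) le_rfl
    rw [hfcF] at hfcM1
    obtain ⟨hfcT', hinT'⟩ := ω.2.fc_succ_eq_of_sOut_W (i := ω.2.firstHitG + (M - 1)) (by omega) houtM1
    rw [hfcM1, show ω.2.firstHitG + (M - 1) + 1 = ω.2.firstHitG + M by omega] at hfcT'
    rw [show ω.2.firstHitG + (M - 1) + 1 = ω.2.firstHitG + M by omega] at hinT'
    have hfcT'' : ω.2.fc (ω.2.firstHitG + M) = (r.1 - M, r.2) := by rw [hfcT']; exact Prod.ext (by simp only; omega) rfl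
    have e := hsvT _ hfMn (hfcT''.trans hfcT.symm)
    exact ⟨e, by rw [← e]; exact hinT'⟩
  ---------------------------------------------------------------- at most ONE isolated turn besides `t, r, b₀, b₁, τ`
  have hne_of_row : ∀ f g : Face, f.2 ≠ g.2 → f ≠ g := fun f g hfg e => hfg (by rw [e])
  have houts : ∀ g₁ g₂ : Face, P g₁ → P g₂ → g₁ ≠ g₂ →
      g₁ ≠ ((r.1 : ℤ) - M, r.2) → g₁ ≠ r → g₁ ≠ ω.2.fc j₀ → g₁ ≠ ω.2.fc j₁ → g₁ ≠ ((τ1 : ℤ), w.2) →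
      g₂ ≠ ((r.1 : ℤ) - M, r.2) → g₂ ≠ r → g₂ ≠ ω.2.fc j₀ → g₂ ≠ ω.2.fc j₁ → g₂ ≠ ((τ1 : ℤ), w.2) → False := by
    intro g₁ g₂ hg₁ hg₂ hne a1 a2 a3 a4 a5 c1 c2 c3 c4 c5
    have hT : ∀ x ∈ ({((r.1 : ℤ) - M, r.2), r, ω.2.fc j₀, ω.2.fc j₁, ((τ1 : ℤ), w.2), g₁, g₂} : Finset Face), P x := by
      intro x hx
      simp only [Finset.mem_insert, Finset.mem_singleton] at hx
      rcases hx with rfl | rfl | rfl | rfl | rfl | rfl | rfl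
      exacts [hPt, hPr, hPb₀, hPb₁, hPτ, hg₁, hg₂]
    have n01 : (((r.1 : ℤ) - M, r.2) : Face) ≠ r := by intro e; have := congrArg Prod.fst e; simp only at this; omega
    have n02 := hne_of_row ((r.1 : ℤ) - M, r.2) (ω.2.fc j₀) (by rw [hrow₀']; simp only; omega)
    have n03 := hne_of_row ((r.1 : ℤ) - M, r.2) (ω.2.fc j₁) (by rw [hrow₁']; simp only; omega)
    have n04 := hne_of_row ((r.1 : ℤ) - M, r.2) ((τ1 : ℤ), w.2) (by simp only; omega)
    have n12 := hne_of_row r (ω.2.fc j₀) (by rw [hrow₀']; omega)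
    have n13 := hne_of_row r (ω.2.fc j₁) (by rw [hrow₁']; omega)
    have n14 := hne_of_row r ((τ1 : ℤ), w.2) (by simp only; omega)
    have n23 := hfne'
    have n24 := hne_of_row (ω.2.fc j₀) ((τ1 : ℤ), w.2) (by rw [hrow₀']; simp only; omega)
    have n34 := hne_of_row (ω.2.fc j₁) ((τ1 : ℤ), w.2) (by rw [hrow₁']; simp only; omega)
    have hcard : ({((r.1 : ℤ) - M, r.2), r, ω.2.fc j₀, ω.2.fc j₁, ((τ1 : ℤ), w.2), g₁, g₂} : Finset Face).card = 7 := by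
      rw [Finset.card_insert_of_notMem (by simp only [Finset.mem_insert, Finset.mem_singleton, not_or]; exact ⟨n01, n02, n03, n04, a1.symm, c1.symm⟩),
        Finset.card_insert_of_notMem (by simp only [Finset.mem_insert, Finset.mem_singleton, not_or]; exact ⟨n12, n13, n14, a2.symm, c2.symm⟩),
        Finset.card_insert_of_notMem (by simp only [Finset.mem_insert, Finset.mem_singleton, not_or]; exact ⟨n23, n24, a3.symm, c3.symm⟩),
        Finset.card_insert_of_notMem (by simp only [Finset.mem_insert, Finset.mem_singleton, not_or]; exact ⟨n34, a4.symm, c4.symm⟩),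
        Finset.card_insert_of_notMem (by simp only [Finset.mem_insert, Finset.mem_singleton, not_or]; exact ⟨a5.symm, c5.symm⟩),
        Finset.card_insert_of_notMem (by simp only [Finset.mem_singleton]; exact hne), Finset.card_singleton]
    have := hle6 _ hT
    omega
  -- an isolated turn of the root row west of the hole, or of a middle row, is an "outsider"
  have hout_row : ∀ g : Face, g.2 = w.2 → g.1 < w.1 →
      g ≠ ((r.1 : ℤ) - M, r.2) ∧ g ≠ r ∧ g ≠ ω.2.fc j₀ ∧ g ≠ ω.2.fc j₁ ∧ g ≠ ((τ1 : ℤ), w.2) := by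
    intro g hg2 hg1
    refine ⟨hne_of_row _ _ (by rw [hg2]; simp only; omega), hne_of_row _ _ (by rw [hg2]; omega),
      hne_of_row _ _ (by rw [hg2, hrow₀']; omega), hne_of_row _ _ (by rw [hg2, hrow₁']; omega), ?_⟩
    intro e; have := congrArg Prod.fst e; simp only at this; omega
  have hout_mid : ∀ g : Face, w.2 < g.2 → g.2 < r.2 →
      g ≠ ((r.1 : ℤ) - M, r.2) ∧ g ≠ r ∧ g ≠ ω.2.fc j₀ ∧ g ≠ ω.2.fc j₁ ∧ g ≠ ((τ1 : ℤ), w.2) := by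
    intro g h1 h2
    exact ⟨hne_of_row _ _ (by simp only; omega), hne_of_row _ _ (by omega), hne_of_row _ _ (by rw [hrow₀']; omega),
      hne_of_row _ _ (by rw [hrow₁']; omega), hne_of_row _ _ (by simp only; omega)⟩
  have hout_low : ∀ g : Face, Y' < g.2 → g.2 < w.2 →
      g ≠ ((r.1 : ℤ) - M, r.2) ∧ g ≠ r ∧ g ≠ ω.2.fc j₀ ∧ g ≠ ω.2.fc j₁ ∧ g ≠ ((τ1 : ℤ), w.2) := by
    intro g h1 h2
    exact ⟨hne_of_row _ _ (by simp only; omega), hne_of_row _ _ (by omega), hne_of_row _ _ (by rw [hrow₀']; omega),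
      hne_of_row _ _ (by rw [hrow₁']; omega), hne_of_row _ _ (by simp only; omega)⟩
  -- an isolated turn of the top row east of `r` is an outsider
  have hout_top : ∀ g : Face, g.2 = r.2 → r.1 < g.1 →
      g ≠ ((r.1 : ℤ) - M, r.2) ∧ g ≠ r ∧ g ≠ ω.2.fc j₀ ∧ g ≠ ω.2.fc j₁ ∧ g ≠ ((τ1 : ℤ), w.2) := by
    intro g hg2 hg1
    refine ⟨fun e => ?_, fun e => ?_, hne_of_row _ _ (by rw [hg2, hrow₀']; omega), hne_of_row _ _ (by rw [hg2, hrow₁']; omega),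
      hne_of_row _ _ (by rw [hg2]; simp only; omega)⟩
    · have := congrArg Prod.fst e; simp only at this; omega
    · have := congrArg Prod.fst e; omega
  ---------------------------------------------------------------- chain ends, packaged
  have hEend : ∀ x y : ℤ, ω.2.UsesSide (x, y) .E → ∃ Mh : ℕ, 1 ≤ Mh ∧ P (x + Mh, y) ∧
      (∀ m : ℕ, 1 ≤ m → m ≤ Mh → ω.2.UsesSide (x + m, y) .W) ∧ (∀ m : ℕ, m < Mh → ω.2.UsesSide (x + m, y) .E) ∧
      ¬ω.2.UsesSide (x + Mh, y) .E := by
    intro x y hEx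
    obtain ⟨Mh, hW', hE', hend'⟩ := ω.2.chain_E hX' hEx
    rcases hend' with ⟨hM1', hnot⟩ | ⟨-, hs0⟩ | ⟨-, hsZ⟩
    · obtain ⟨i, hi, hfci, hsv, -, -, -, hk'⟩ := ω.2.isolated_of_usesSide_not_opp (hW' Mh hM1' le_rfl) hnot
      exact ⟨Mh, hM1', by rw [← hfci]; exact hPiso i hi hsv hk', hW', hE', hnot⟩
    · exact absurd hs0 h0E
    · exact absurd hsZ hzE'
  have hWend : ∀ x y : ℤ, ω.2.UsesSide (x, y) .W → y ≠ w.2 → y ≠ r.2 → ∃ Mh : ℕ, 1 ≤ Mh ∧ P (x - Mh, y) ∧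
      (∀ m : ℕ, 1 ≤ m → m ≤ Mh → ω.2.UsesSide (x - m, y) .E) ∧ (∀ m : ℕ, m < Mh → ω.2.UsesSide (x - m, y) .W) ∧
      ¬ω.2.UsesSide (x - Mh, y) .W := by
    intro x y hW hyw hyr
    obtain ⟨Mh, hE', hW', hend'⟩ := ω.2.chain_W hX hW
    rcases hend' with ⟨hM1', hnot⟩ | ⟨hA0, -⟩ | ⟨hZ, -⟩
    · obtain ⟨i, hi, hfci, hsv, -, -, -, hk'⟩ := ω.2.isolated_of_usesSide_not_opp (hE' Mh hM1' le_rfl) hnot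
      exact ⟨Mh, hM1', by rw [← hfci]; exact hPiso i hi hsv hk', hE', hW', hnot⟩
    · rw [h0w] at hA0; have := congrArg Prod.snd hA0; simp only at this; exact absurd this hyw
    · rw [hfcZ] at hZ; have := congrArg Prod.snd hZ; simp only at this; exact absurd this hyr
  have hNend : ∀ x y : ℤ, ω.2.UsesSide (x, y) .N → ∃ Mv : ℕ, 1 ≤ Mv ∧ y + Mv ≤ r.2 ∧ P (x, y + Mv) ∧
      (∀ m : ℕ, 1 ≤ m → m ≤ Mv → ω.2.UsesSide (x, y + m) .S) ∧ (∀ m : ℕ, m < Mv → ω.2.UsesSide (x, y + m) .N) ∧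
      ¬ω.2.UsesSide (x, y + Mv) .N ∧ (ω.2.UsesSide (x, y + Mv) .W ∨ ω.2.UsesSide (x, y + Mv) .E) ∧
      ∃ i < n, ω.2.fc i = (x, y + Mv) ∧ (∀ l < n, ω.2.fc l = ω.2.fc i → l = i) ∧ (ω.2.sIn i = .S ∨ ω.2.sOut i = .S) ∧
        arcKind (ω.2.sIn i) (ω.2.sOut i) ≠ .straight := by
    intro x y hN
    obtain ⟨Mv, hS', hN', hend'⟩ := ω.2.chain_N htop hN
    obtain ⟨hM1', hnot⟩ : 1 ≤ Mv ∧ ¬ω.2.UsesSide (x, y + Mv) .N := by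
      rcases hend' with hT | ⟨-, hs0⟩ | ⟨-, hsZ⟩
      · exact hT
      · exact absurd hs0 h0N
      · exact absurd hsZ hzN'
    obtain ⟨i, hi, hfci, hsv, hSi, -, -, hk'⟩ := ω.2.isolated_of_usesSide_not_opp (hS' Mv hM1' le_rfl) hnot
    refine ⟨Mv, hM1', ?_, ?_, hS', hN', hnot, ?_, i, hi, hfci, hsv, hSi, hk'⟩
    · have := htop i hi; rw [hfci] at this; exact this
    · rw [← hfci]; exact hPiso i hi hsv hk'
    · rw [← hfci]; exact hHor i hi hk'
  have hSend : ∀ x y : ℤ, ω.2.UsesSide (x, y) .S → ∃ Mv : ℕ, 1 ≤ Mv ∧ Y' ≤ y - Mv ∧ P (x, y - Mv) ∧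
      (∀ m : ℕ, 1 ≤ m → m ≤ Mv → ω.2.UsesSide (x, y - m) .N) ∧ (∀ m : ℕ, m < Mv → ω.2.UsesSide (x, y - m) .S) ∧
      ¬ω.2.UsesSide (x, y - Mv) .S ∧ (ω.2.UsesSide (x, y - Mv) .W ∨ ω.2.UsesSide (x, y - Mv) .E) ∧
      ∃ i < n, ω.2.fc i = (x, y - Mv) ∧ (∀ l < n, ω.2.fc l = ω.2.fc i → l = i) ∧ (ω.2.sIn i = .N ∨ ω.2.sOut i = .N) ∧
        arcKind (ω.2.sIn i) (ω.2.sOut i) ≠ .straight := by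
    intro x y hS
    obtain ⟨Mv, hN', hS', hend'⟩ := ω.2.chain_S hY' hS
    obtain ⟨hM1', hnot⟩ : 1 ≤ Mv ∧ ¬ω.2.UsesSide (x, y - Mv) .S := by
      rcases hend' with hT | ⟨-, hs0⟩ | ⟨-, hsZ⟩
      · exact hT
      · exact absurd hs0 h0S
      · exact absurd hsZ hzS'
    obtain ⟨i, hi, hfci, hsv, hNi, -, -, hk'⟩ := ω.2.isolated_of_usesSide_not_opp (hN' Mv hM1' le_rfl) hnot
    refine ⟨Mv, hM1', ?_, ?_, hN', hS', hnot, ?_, i, hi, hfci, hsv, hNi, hk'⟩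
    · have := hY' i hi; rw [hfci] at this; exact this
    · rw [← hfci]; exact hPiso i hi hsv hk'
    · rw [← hfci]; exact hHor i hi hk'
  ---------------------------------------------------------------- outsider killers
  -- a horizontal chain from an isolated turn `g` of a row strictly between the bottom row and the top row, other than the root row, ends at a second outsider
  have hmid_kill : ∀ (g : Face), P g → Y' < g.2 → g.2 < r.2 → g.2 ≠ w.2 → (ω.2.UsesSide g .W ∨ ω.2.UsesSide g .E) → False := by
    intro g hPg h1 h2 h3 hgEW
    have hog : ∀ g' : Face, g'.2 = g.2 →
        g' ≠ ((r.1 : ℤ) - M, r.2) ∧ g' ≠ r ∧ g' ≠ ω.2.fc j₀ ∧ g' ≠ ω.2.fc j₁ ∧ g' ≠ ((τ1 : ℤ), w.2) := by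
      intro g' hg'
      rcases lt_or_gt_of_ne h3 with hl | hg
      · exact hout_low g' (by omega) (by omega)
      · exact hout_mid g' (by omega) (by omega)
    obtain ⟨p1, p2, p3, p4, p5⟩ := hog g rfl
    rcases hgEW with hW | hEx
    · obtain ⟨M₁, hM₁, hP₁, -, -, -⟩ := hWend g.1 g.2 hW h3 (by omega)
      obtain ⟨c1, c2, c3, c4, c5⟩ := hog (g.1 - M₁, g.2) rfl
      exact houts _ _ hPg hP₁ (fun e => by have := congrArg Prod.fst e; simp only at this; omega) p1 p2 p3 p4 p5 c1 c2 c3 c4 c5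
    · obtain ⟨M₂, hM₂, hP₂, -, -, -⟩ := hEend g.1 g.2 hEx
      obtain ⟨c1, c2, c3, c4, c5⟩ := hog (g.1 + M₂, g.2) rfl
      exact houts _ _ hPg hP₂ (fun e => by have := congrArg Prod.fst e; simp only at this; omega) p1 p2 p3 p4 p5 c1 c2 c3 c4 c5
  -- hence no plaquette of such a row with a `W`-chain: its end would be such a turn
  have hWkill : ∀ x y : ℤ, ω.2.UsesSide (x, y) .W → Y' < y → y < r.2 → y ≠ w.2 → False := by
    intro x y hW h1 h2 h3
    obtain ⟨M₁, hM₁, hP₁, hE₁, -, -⟩ := hWend x y hW h3 (by omega)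
    exact hmid_kill _ hP₁ h1 h2 h3 (Or.inr (hE₁ M₁ hM₁ le_rfl))
  -- and a vertical chain end strictly inside such a row is impossible
  have hNtop_of : ∀ x y : ℤ, ∀ Mv : ℕ, P (x, y + Mv) → w.2 ≤ y → y + Mv ≤ r.2 →
      (ω.2.UsesSide (x, y + Mv) .W ∨ ω.2.UsesSide (x, y + Mv) .E) → 1 ≤ Mv → y + Mv = r.2 := by
    intro x y Mv hP hy hle hU hM
    rcases lt_or_eq_of_le hle with hlt | heq
    · exact (hmid_kill _ hP (by simp only; omega) (by simp only; exact hlt) (by simp only; omega) hU).elim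
    · exact heq
  have hSbot_of : ∀ x y : ℤ, ∀ Mv : ℕ, P (x, y - Mv) → y ≤ w.2 → Y' ≤ y - Mv →
      (ω.2.UsesSide (x, y - Mv) .W ∨ ω.2.UsesSide (x, y - Mv) .E) → 1 ≤ Mv → y - Mv = Y' := by
    intro x y Mv hP hy hle hU hM
    rcases lt_or_eq_of_le hle with hlt | heq
    · exact (hmid_kill _ hP (by simp only; exact hlt) (by simp only; omega) (by simp only; omega) hU).elim
    · exact heq.symm
  ---------------------------------------------------------------- the column under `r`: its `S`-chain ends at an isolated turn `e = (r.1, r.2 − Mc)`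
  obtain ⟨Mc, hNc, hSc, hendc⟩ := ω.2.chain_S hY' ⟨_, hF, hfcF, Or.inl hSin⟩
  obtain ⟨hMc1, hnotS⟩ : 1 ≤ Mc ∧ ¬ω.2.UsesSide (r.1, r.2 - Mc) .S := by
    rcases hendc with hT | ⟨-, hs0⟩ | ⟨-, hsZ⟩
    · exact hT
    · exact absurd hs0 h0S
    · exact absurd hsZ hzS'
  obtain ⟨iE, hiE, hfcE, hsvE, hNE, hninE, hnoutE, hkE⟩ := ω.2.isolated_of_usesSide_not_opp (hNc Mc hMc1 le_rfl) hnotS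
  have hPe : P (r.1, r.2 - Mc) := by rw [← hfcE]; exact hPiso iE hiE hsvE hkE
  have heY' : Y' ≤ r.2 - Mc := by have := hY' iE hiE; rw [hfcE] at this; exact this
  have hneE := ω.2.sIn_ne_sOut hiE
  have heUses : ω.2.UsesSide (r.1, r.2 - Mc) .W ∨ ω.2.UsesSide (r.1, r.2 - Mc) .E := by rw [← hfcE]; exact hHor iE hiE hkE
  -- F2: `r` stands on the first turn
  have hrk : r.1 = w.1 + k := fst_eq_firstTurn_of_cost_seven_E_above hh hr h hA hc hE hNS habove hcol hk hstrk hturnk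
  ---------------------------------------------------------------- `e` is not on a middle row (two outsiders): it is on the root row or below
  have hMc : (r.2 : ℤ) - w.2 ≤ Mc := by
    by_contra hlt
    exact hmid_kill _ hPe (by simp only; omega) (by simp only; omega) (by simp only; omega) heUses
  -- the column cells strictly between `e` and `r` other than the root-row cell `q = (r.1, w.2)` are straight
  have hcolSt : ∀ m : ℕ, 1 ≤ m → m < Mc → (r.2 : ℤ) - m ≠ w.2 → ∀ i < n, ω.2.fc i = (r.1, r.2 - m) →
      arcKind (ω.2.sIn i) (ω.2.sOut i) = .straight :=
    fun m hm1 hmM hmw => ω.2.straight_of_usesSide_NS (hNc m hm1 hmM.le) (hSc m hmM)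
      (fun hW => hWkill _ _ hW (by omega) (by omega) hmw)
  -- reading the column backwards from `r`: the cell `(r.1, r.2 − m)`, `m ≤ M₀ = r.2 − w.2 − 1`, is crossed upwards by the arc `firstHitG − m`
  set M₀ : ℕ := (r.2 - w.2 - 1).toNat with hM₀
  have hM₀' : (M₀ : ℤ) = r.2 - w.2 - 1 := by omega
  have hcellsS : ∀ m : ℕ, 1 ≤ m → m ≤ M₀ → ∀ i < n,
      ω.2.fc i = ((ω.2.fc ω.2.firstHitG).1, (ω.2.fc ω.2.firstHitG).2 - m) → arcKind (ω.2.sIn i) (ω.2.sOut i) = .straight := by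
    intro m hm1 hmM i hi hfi
    rw [hfcF] at hfi
    exact hcolSt m hm1 (by omega) (by omega) i hi hfi
  have hM₀F : M₀ + 1 ≤ ω.2.firstHitG := by
    by_contra hlt
    push Not at hlt
    obtain ⟨-, hin0⟩ := ω.2.run_back_below_of_straight hF le_rfl hSin
      (fun m hm1 hmM i hi hfi => hcellsS m hm1 (by omega) i hi hfi) ω.2.firstHitG le_rfl
    rw [Nat.sub_self, h0W] at hin0
    exact absurd hin0 (by decide)
  have hrunS := ω.2.run_back_below_of_straight hF (show M₀ ≤ ω.2.firstHitG by omega) hSin hcellsS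
  -- the arc `iq := firstHitG − (M₀ + 1)` lies in `q` and leaves it through `N`
  obtain ⟨hfcq, hNq⟩ : ω.2.fc (ω.2.firstHitG - (M₀ + 1)) = (r.1, w.2) ∧ ω.2.sOut (ω.2.firstHitG - (M₀ + 1)) = .N := by
    obtain ⟨hfcM, hinM⟩ := hrunS M₀ le_rfl
    rw [hfcF] at hfcM
    obtain ⟨hfc', hout'⟩ := fc_sOut_pred_of_sIn_S ω.2 (i := ω.2.firstHitG - M₀) (by omega) (by omega) hinM
    rw [show ω.2.firstHitG - M₀ - 1 = ω.2.firstHitG - (M₀ + 1) by omega] at hfc' hout'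
    refine ⟨?_, hout'⟩
    rw [hfc', hfcM]; exact Prod.ext rfl (by simp only; omega)
  set iq := ω.2.firstHitG - (M₀ + 1) with hiq
  have hiqn : iq < n := by omega
  -- the column cells above the root row, with their arcs `firstHitG − m`
  have hupidx : ∀ l < n, ∀ m : ℕ, 1 ≤ m → m ≤ M₀ → ω.2.fc l = (r.1, r.2 - m) → l = ω.2.firstHitG - m := by
    intro l hl m hm1 hmM hfl
    obtain ⟨hfcm, -⟩ := hrunS m hmM
    rw [hfcF] at hfcm
    by_contra hne
    have := (ω.2.not_straight_of_two_arcs (show ω.2.firstHitG - m < n by omega) hl (Ne.symm hne) (hfl.trans hfcm.symm)).1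
    exact this (ω.2.sOut_of_straight (by omega) (hcellsS m hm1 hmM _ (by omega) (by rw [hfcF]; exact hfcm)))
  ---------------------------------------------------------------- a doubly visited plaquette lies on the root row, in the column of `r` or east of it
  have hkiss_pre : ∀ i j : ℕ, i < n → j < n → ω.2.fc i = ω.2.fc j → i ≠ j → (ω.2.fc i).2 = w.2 ∧ r.1 ≤ (ω.2.fc i).1 := by
    intro i j hi hj hfij hij
    have hall : ∀ s, ω.2.UsesSide ((ω.2.fc i).1, (ω.2.fc i).2) s := fun s => ω.2.usesSide_of_fc_eq hi hj hij hfij s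
    have hr1 : Y' ≤ (ω.2.fc i).2 := hY' i hi
    have hr2 : (ω.2.fc i).2 ≤ r.2 := htop i hi
    -- not on the top row, not on the bottom row
    have hnt : (ω.2.fc i).2 ≠ r.2 := fun e => hij (hsvTop i hi e j hj hfij.symm).symm
    have hnb : (ω.2.fc i).2 ≠ Y' := fun e => hij (hsvB i hi e j hj hfij.symm).symm
    -- not on a middle row
    have hroww : (ω.2.fc i).2 = w.2 := by
      by_contra hne
      exact hWkill _ _ (hall .W) (by omega) (by omega) hne
    refine ⟨hroww, ?_⟩
    by_contra hlt
    push Not at hlt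
    rcases lt_trichotomy (ω.2.fc i).1 (w.1 - 1) with hwest | hhole | heast
    · -- west of the hole: both horizontal chains end at outsiders west of the hole
      obtain ⟨M₁, hE₁, -, hend₁⟩ := ω.2.chain_W hX (hall .W)
      obtain ⟨hP₁, hM₁1⟩ : P ((ω.2.fc i).1 - M₁, w.2) ∧ 1 ≤ M₁ := by
        rcases hend₁ with ⟨hM1', hnot⟩ | ⟨hA0, -⟩ | ⟨hZ, -⟩
        · obtain ⟨i₁, hi₁, hfc₁, hsv₁, -, -, -, hk₁'⟩ := ω.2.isolated_of_usesSide_not_opp (hE₁ M₁ hM1' le_rfl) hnot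
          refine ⟨?_, hM1'⟩
          have := hPiso i₁ hi₁ hsv₁ hk₁'
          rw [hfc₁, hroww] at this; exact this
        · rw [h0w] at hA0; have := congrArg Prod.fst hA0; simp only at this; omega
        · rw [hfcZ] at hZ; have := congrArg Prod.snd hZ; simp only at this; omega
      obtain ⟨M₂, hM₂, hP₂, hW₂, -, -⟩ := hEend _ _ (hall .E)
      rw [hroww] at hP₂ hW₂
      have hM₂h : (ω.2.fc i).1 + M₂ ≤ w.1 - 2 := by
        by_contra hge
        have hD := hPD _ _ (hW₂ (w.1 - 1 - (ω.2.fc i).1).toNat (by omega) (by omega))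
        have e : (((ω.2.fc i).1 + ((w.1 - 1 - (ω.2.fc i).1).toNat : ℕ), w.2) : Face) = holeFaceW w := by
          simp only [holeFaceW]; exact Prod.ext (by simp only; omega) rfl
        rw [e] at hD; exact hh hD
      obtain ⟨a1, a2, a3, a4, a5⟩ := hout_row (((ω.2.fc i).1 - M₁, w.2) : Face) rfl (by simp only; omega)
      obtain ⟨c1, c2, c3, c4, c5⟩ := hout_row (((ω.2.fc i).1 + M₂, w.2) : Face) rfl (by simp only; omega)
      exact houts _ _ hP₁ hP₂ (fun e => by have := congrArg Prod.fst e; simp only at this; omega) a1 a2 a3 a4 a5 c1 c2 c3 c4 c5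
    · -- the hole itself
      have hD := hPD _ _ (hall .W)
      have e : (((ω.2.fc i).1, (ω.2.fc i).2) : Face) = holeFaceW w := by
        simp only [holeFaceW]; exact Prod.ext (by simp only; omega) (by simp only; omega)
      rw [e] at hD; exact hh hD
    · -- on the initial run: a straight, singly visited cell
      have hm₀ : ((ω.2.fc i).1 - w.1).toNat < k := by omega
      obtain ⟨hfm, -⟩ := hrun ((ω.2.fc i).1 - w.1).toNat hm₀.le
      have hsm := hstr _ hm₀
      have hfi' : ω.2.fc i = ω.2.fc ((ω.2.fc i).1 - w.1).toNat := by
        rw [hfm]; exact Prod.ext (by simp only; omega) (by simp only; omega)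
      rcases eq_or_ne i ((ω.2.fc i).1 - w.1).toNat with hei | hnei
      · have hnej : j ≠ ((ω.2.fc i).1 - w.1).toNat := fun e => hij (hei.trans e.symm)
        exact (ω.2.not_straight_of_two_arcs (show ((ω.2.fc i).1 - w.1).toNat < n by omega) hj hnej.symm (hfij.symm.trans hfi')).1
          (ω.2.sOut_of_straight (by omega) hsm)
      · exact (ω.2.not_straight_of_two_arcs (show ((ω.2.fc i).1 - w.1).toNat < n by omega) hi hnei.symm hfi').1
          (ω.2.sOut_of_straight (by omega) hsm)
  -- east of `p₁`: the west chain of a kiss ends at a root-row outsider east of `p₁`, or reaches `w` through `p₁` (which then uses `E`)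
  have hkiss_east : ∀ i j : ℕ, i < n → j < n → ω.2.fc i = ω.2.fc j → i ≠ j → r.1 < (ω.2.fc i).1 →
      (∃ g : Face, P g ∧ g.2 = w.2 ∧ r.1 < g.1 ∧ g.1 < (ω.2.fc i).1 ∧ ¬ω.2.UsesSide g .W ∧
          g ≠ ((r.1 : ℤ) - M, r.2) ∧ g ≠ r ∧ g ≠ ω.2.fc j₀ ∧ g ≠ ω.2.fc j₁ ∧ g ≠ ((τ1 : ℤ), w.2)) ∨
        (ω.2.UsesSide (w.1 + k, w.2) .E ∧ (∀ m : ℕ, 1 ≤ m → (m : ℤ) ≤ (ω.2.fc i).1 - w.1 → ω.2.UsesSide ((ω.2.fc i).1 - m, w.2) .E) ∧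
          ∀ m : ℕ, (m : ℤ) < (ω.2.fc i).1 - w.1 → ω.2.UsesSide ((ω.2.fc i).1 - m, w.2) .W) := by
    intro i j hi hj hfij hij heast
    obtain ⟨hroww, -⟩ := hkiss_pre i j hi hj hfij hij
    have hall : ∀ s, ω.2.UsesSide ((ω.2.fc i).1, (ω.2.fc i).2) s := fun s => ω.2.usesSide_of_fc_eq hi hj hij hfij s
    obtain ⟨M₁, hE₁, hW₁, hend₁⟩ := ω.2.chain_W hX (hall .W)
    rw [hroww] at hE₁ hW₁ hend₁
    rcases hend₁ with ⟨hM1', hnot⟩ | ⟨hA0, -⟩ | ⟨hZ, -⟩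
    · left
      obtain ⟨i₁, hi₁, hfc₁, hsv₁, -, -, -, hk₁'⟩ := ω.2.isolated_of_usesSide_not_opp (hE₁ M₁ hM1' le_rfl) hnot
      have hP₁ : P ((ω.2.fc i).1 - M₁, w.2) := by rw [← hfc₁]; exact hPiso i₁ hi₁ hsv₁ hk₁'
      -- the end lies east of `p₁`: every cell from `w` to `p₁` uses `W`, the hole is not visited, and the chain does not jump the hole
      have hgt : r.1 < (ω.2.fc i).1 - M₁ := by
        by_contra hle
        push Not at hle
        rcases lt_trichotomy ((ω.2.fc i).1 - (M₁ : ℤ)) (w.1 - 1) with hw | hh' | he'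
        · -- the chain passed the hole
          have hD := hPD _ _ (hW₁ ((ω.2.fc i).1 - (w.1 - 1)).toNat (by omega))
          have e : (((ω.2.fc i).1 - (((ω.2.fc i).1 - (w.1 - 1)).toNat : ℕ), w.2) : Face) = holeFaceW w := by
            simp only [holeFaceW]; exact Prod.ext (by simp only; omega) rfl
          rw [e] at hD; exact hh hD
        · have hD := hPD _ _ (hE₁ M₁ hM1' le_rfl)
          have e : (((ω.2.fc i).1 - (M₁ : ℤ), w.2) : Face) = holeFaceW w := by
            simp only [holeFaceW]; exact Prod.ext (by simp only; omega) rfl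
          rw [e] at hD; exact hh hD
        · -- between `w` and `p₁`: these cells use `W`
          apply hnot
          rcases lt_or_eq_of_le hle with hlt' | heq'
          · obtain ⟨hfm, hWm⟩ := hrun ((ω.2.fc i).1 - M₁ - w.1).toNat (by omega)
            refine ⟨_, by omega, ?_, Or.inl hWm⟩
            rw [hfm]; exact Prod.ext (by simp only; omega) rfl
          · rw [heq', hrk]; exact hp₁W
      refine ⟨_, hP₁, rfl, hgt, by simp only; omega, hnot, hne_of_row _ _ (by simp only; omega), hne_of_row _ _ (by simp only; omega),
        hne_of_row _ _ (by rw [hrow₀']; simp only; omega), hne_of_row _ _ (by rw [hrow₁']; simp only; omega), fun e => hnot ?_⟩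
      rw [e]; exact hτW
    · right
      rw [h0w] at hA0
      have hM₁w : (M₁ : ℤ) = (ω.2.fc i).1 - w.1 := by have := congrArg Prod.fst hA0; simp only at this; omega
      refine ⟨?_, fun m hm1 hm2 => hE₁ m hm1 (by omega), fun m hm => hW₁ m (by omega)⟩
      have := hE₁ ((ω.2.fc i).1 - r.1).toNat (by omega) (by omega)
      rwa [show (ω.2.fc i).1 - (((ω.2.fc i).1 - r.1).toNat : ℕ) = w.1 + k by omega] at this
    · rw [hfcZ] at hZ; have := congrArg Prod.snd hZ; simp only at this; omega
  rcases lt_or_eq_of_le hMc with hlow | hroot'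
  swap
  · ---------------------------------------------------------------- `e` on the root row: `e = p₁` is singly visited, the arc `k` is its arc, no kiss anywhere
    have hroot : (r.2 : ℤ) - Mc = w.2 := by omega
    rw [hroot] at hfcE hPe heUses hnotS
    have hiqE : iq = iE := hsvE _ hiqn (hfcq.trans hfcE.symm)
    have hkE' : k = iE := hsvE _ hk₁ (by rw [hfk, hfcE, hrk])
    have hfhk : ω.2.firstHitG = k + (M₀ + 1) := by omega
    have hkN : ω.2.sOut k = .N := by rw [hkE', ← hiqE]; exact hNq
    -- `p₁` does not use `E`
    have hpnE : ¬ω.2.UsesSide (w.1 + k, w.2) .E := by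
      rintro ⟨b, hb, hfb, hbE⟩
      have hbk : b = k := by rw [hkE']; exact hsvE b hb (by rw [hfb, hfcE, hrk])
      rw [hbk, hWk, hkN] at hbE
      rcases hbE with e | e <;> exact absurd e (by decide)
    refine ⟨hWk, hkN, by omega, fun i hi hik => ?_, fun i j hi hj hfij hij => ?_⟩
    · rcases Nat.lt_or_ge i k with hlt | hge
      · exact hstrk i hlt
      · obtain ⟨hfcm, -⟩ := hrunS (ω.2.firstHitG - i) (by omega)
        rw [show ω.2.firstHitG - (ω.2.firstHitG - i) = i by omega] at hfcm
        exact hcellsS (ω.2.firstHitG - i) (by omega) (by omega) i (by omega) hfcm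
    · exfalso
      obtain ⟨hroww, hcol1⟩ := hkiss_pre i j hi hj hfij hij
      rcases lt_or_eq_of_le hcol1 with heast | heq1
      · rcases hkiss_east i j hi hj hfij hij heast with ⟨g, hPg, hg2, hg1, hg1', hgW, a1, a2, a3, a4, a5⟩ | ⟨hpE', -, -⟩
        · -- the east chain of the kiss ends at a second outsider (`τ = p₁` lies west of it)
          have hall : ∀ s, ω.2.UsesSide ((ω.2.fc i).1, (ω.2.fc i).2) s := fun s => ω.2.usesSide_of_fc_eq hi hj hij hfij s
          obtain ⟨M₂, hM₂, hP₂, -, -, hnot₂⟩ := hEend _ _ (hall .E)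
          rw [hroww] at hP₂ hnot₂
          have hτp : (τ1 : ℤ) = w.1 + k := by
            rcases hτalt with ⟨heq', -⟩ | ⟨-, hpE', -, -⟩
            · exact heq'
            · exact absurd hpE' hpnE
          obtain ⟨c1, c2, c3, c4, c5⟩ : (((ω.2.fc i).1 + (M₂ : ℤ), w.2) : Face) ≠ ((r.1 : ℤ) - M, r.2) ∧ (((ω.2.fc i).1 + (M₂ : ℤ), w.2) : Face) ≠ r ∧
              (((ω.2.fc i).1 + (M₂ : ℤ), w.2) : Face) ≠ ω.2.fc j₀ ∧ (((ω.2.fc i).1 + (M₂ : ℤ), w.2) : Face) ≠ ω.2.fc j₁ ∧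
              (((ω.2.fc i).1 + (M₂ : ℤ), w.2) : Face) ≠ ((τ1 : ℤ), w.2) :=
            ⟨hne_of_row _ _ (by simp only; omega), hne_of_row _ _ (by simp only; omega), hne_of_row _ _ (by rw [hrow₀']; simp only; omega),
              hne_of_row _ _ (by rw [hrow₁']; simp only; omega), fun e => by have := congrArg Prod.fst e; simp only at this; omega⟩
          exact houts _ _ hPg hP₂ (fun e => by have := congrArg Prod.fst e; simp only at this; omega) a1 a2 a3 a4 a5 c1 c2 c3 c4 c5
        · exact hpnE hpE'
      · -- `p₁` itself is singly visited
        have hfi : ω.2.fc i = ω.2.fc iE := by rw [hfcE]; exact Prod.ext heq1.symm hroww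
        have h1 := hsvE i hi hfi
        have h2 := hsvE j hj (hfij.symm.trans hfi)
        exact hij (h1.trans h2.symm)
  · ---------------------------------------------------------------- `e` below the root row: `p₁` is doubly visited and the column of `r` is a wall down to the bottom row
    have heq : (r.2 : ℤ) - Mc = Y' := by
      rcases lt_or_eq_of_le heY' with hlt | heq
      · exact (hmid_kill _ hPe (by simp only; exact hlt) (by simp only; omega) (by simp only; omega) heUses).elim
      · exact heq.symm
    have hqN : ω.2.UsesSide (r.1, w.2) .N := by rw [← hfcq]; exact ⟨iq, hiqn, rfl, Or.inr hNq⟩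
    have hqS : ω.2.UsesSide (r.1, w.2) .S := by
      have := hSc (M₀ + 1) (by omega)
      rwa [show (r.2 : ℤ) - ((M₀ + 1 : ℕ) : ℤ) = w.2 by push_cast; omega] at this
    -- `τ ≠ q` (`q` uses `N`, `S` and — if it were `τ` — `W` but not `E`: three sides for one arc)
    have hτq : (τ1 : ℤ) ≠ r.1 := by
      intro e
      rw [e] at hτW hτnE
      obtain ⟨a, ha, hfa, hsa⟩ := hqN
      obtain ⟨b, hb, hfb, hsb⟩ := hqS
      obtain ⟨c, hc', hfc', hsc⟩ := hτW
      have eab := ω.2.single_visit_of_not_usesSide hτnE ha hb hfa hfb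
      have eac := ω.2.single_visit_of_not_usesSide hτnE ha hc' hfa hfc'
      subst eab; subst eac
      have hne := ω.2.sIn_ne_sOut ha
      revert hsa hsb hsc hne; cases ω.2.sIn a <;> cases ω.2.sOut a <;> decide
    -- `q = p₁` uses `W` (the first turn enters it from `W`): it is doubly visited
    have hqW : ω.2.UsesSide (r.1, w.2) .W := by rw [hrk]; exact hp₁W
    have hτgt : r.1 < (τ1 : ℤ) := by
      by_contra hle
      have hτlt : (τ1 : ℤ) < r.1 := lt_of_le_of_ne (not_lt.1 hle) hτq
      obtain ⟨M₁, hE₁, -, hend₁⟩ := ω.2.chain_W hX hqW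
      -- the chain does not reach the column of `τ` (`τ` does not use `E`)
      have hM₁τ : (τ1 : ℤ) < r.1 - M₁ := by
        by_contra hge
        have := hE₁ (r.1 - τ1).toNat (by omega) (by omega)
        apply hτnE
        have e2 : ((((r.1 : ℤ), w.2) : Face).1 - (((r.1 - τ1).toNat : ℕ) : ℤ), (((r.1 : ℤ), w.2) : Face).2) = ((τ1 : ℤ), w.2) :=
          Prod.ext (by simp only; omega) rfl
        rwa [e2] at this
      obtain ⟨hP₁, hM1'⟩ : P ((r.1 : ℤ) - M₁, w.2) ∧ 1 ≤ M₁ := by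
        rcases hend₁ with ⟨hM1', hnot⟩ | ⟨hA0, -⟩ | ⟨hZ, -⟩
        · obtain ⟨i₁, hi₁, hfc₁, hsv₁, -, -, -, hk₁'⟩ := ω.2.isolated_of_usesSide_not_opp (hE₁ M₁ hM1' le_rfl) hnot
          exact ⟨by rw [← hfc₁]; exact hPiso i₁ hi₁ hsv₁ hk₁', hM1'⟩
        · rw [h0w] at hA0; have := congrArg Prod.fst hA0; simp only at this; omega
        · rw [hfcZ] at hZ; have := congrArg Prod.snd hZ; simp only at this; omega
      have hqE : ω.2.UsesSide (r.1, w.2) .E := by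
        by_contra hnE
        obtain ⟨a, ha, hfa, hsa⟩ := hqN
        obtain ⟨b, hb, hfb, hsb⟩ := hqS
        obtain ⟨c, hc', hfc', hsc⟩ := hqW
        have eab := ω.2.single_visit_of_not_usesSide hnE ha hb hfa hfb
        have eac := ω.2.single_visit_of_not_usesSide hnE ha hc' hfa hfc'
        subst eab; subst eac
        have hne := ω.2.sIn_ne_sOut ha
        revert hsa hsb hsc hne; cases ω.2.sIn a <;> cases ω.2.sOut a <;> decide
      obtain ⟨M₂, hM₂, hP₂, -, -, -⟩ := hEend _ _ hqE
      exact houts _ _ hP₁ hP₂ (fun e => by have := congrArg Prod.fst e; simp only at this; omega)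
        (hne_of_row _ _ (by simp only; omega)) (hne_of_row _ _ (by simp only; omega))
        (hne_of_row _ _ (by rw [hrow₀']; simp only; omega)) (hne_of_row _ _ (by rw [hrow₁']; simp only; omega))
        (fun e => by have := congrArg Prod.fst e; simp only at this; omega)
        (hne_of_row _ _ (by simp only; omega)) (hne_of_row _ _ (by simp only; omega))
        (hne_of_row _ _ (by rw [hrow₀']; simp only; omega)) (hne_of_row _ _ (by rw [hrow₁']; simp only; omega))
        (fun e => by have := congrArg Prod.fst e; simp only at this; omega)
    -- so `q` is interior to `p₁`'s `E`-chain: `p₁` is doubly visited and `τ` lies east of `q`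
    obtain ⟨hpE, hτWs, hτEs⟩ : ω.2.UsesSide (w.1 + k, w.2) .E ∧
        (∀ m : ℕ, 1 ≤ m → (m : ℤ) ≤ τ1 - (w.1 + k) → ω.2.UsesSide (w.1 + k + m, w.2) .W) ∧
        ∀ m : ℕ, (m : ℤ) < τ1 - (w.1 + k) → ω.2.UsesSide (w.1 + k + m, w.2) .E := by
      rcases hτalt with ⟨heq', -⟩ | ⟨-, h1, h2, h3⟩
      · exfalso; omega
      · exact ⟨h1, h2, h3⟩
    ---- the two arcs of `q`: `iq` (`h → N`, before the first hit) and `iq'` (through `S` and the other horizontal side)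
    obtain ⟨iq', hiq'n, hfcq', hSq'⟩ := hqS
    have hqq : iq ≠ iq' := by
      intro e
      rw [← e] at hSq'
      have hSin' : ω.2.sIn iq = .S := by
        rcases hSq' with h' | h'
        · exact h'
        · rw [hNq] at h'; exact absurd h' (by decide)
      obtain ⟨c, hc', hfc', hsc⟩ := hqW
      have hcq : c ≠ iq := by
        rintro rfl
        rw [hSin', hNq] at hsc
        rcases hsc with h' | h' <;> exact absurd h' (by decide)
      have := (ω.2.not_straight_of_two_arcs hiqn hc' (Ne.symm hcq) (hfc'.trans hfcq.symm)).1
      rw [hSin', hNq] at this; exact this rfl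
    obtain ⟨hturnq, d1, d2, d3, d4⟩ := ω.2.not_straight_of_two_arcs hiqn hiq'n hqq (hfcq'.trans hfcq.symm)
    rw [hNq] at hturnq d2 d4
    have hqidx : ∀ l < n, ω.2.fc l = (r.1, w.2) → l = iq ∨ l = iq' :=
      fun l hl hfl => ω.2.eq_or_eq_of_fc_eq_three hiqn hiq'n hl hqq (hfcq'.trans hfcq.symm) (hfl.trans hfcq.symm)
    have hinq : ω.2.sIn iq = .W ∨ ω.2.sIn iq = .E := by
      have hne := ω.2.sIn_ne_sOut hiqn
      rw [hNq] at hne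
      revert hturnq hne; cases ω.2.sIn iq <;> decide
    ---- classification of the arcs in column `r.1`
    have hCcls : ∀ l < n, (ω.2.fc l).1 = r.1 →
        l = ω.2.firstHitG ∨ (∃ m : ℕ, 1 ≤ m ∧ m ≤ M₀ ∧ l = ω.2.firstHitG - m) ∨ (l = iq ∨ l = iq') ∨
          (∃ m : ℕ, M₀ + 2 ≤ m ∧ m ≤ Mc - 1 ∧ ω.2.fc l = (r.1, r.2 - m)) ∨ l = iE := by
      intro l hl hcol1
      have hr1 : Y' ≤ (ω.2.fc l).2 := hY' l hl
      have hr2 : (ω.2.fc l).2 ≤ r.2 := htop l hl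
      obtain ⟨m, hm⟩ : ∃ m : ℕ, (m : ℤ) = r.2 - (ω.2.fc l).2 := ⟨(r.2 - (ω.2.fc l).2).toNat, by omega⟩
      have hfl : ω.2.fc l = (r.1, r.2 - m) := Prod.ext hcol1 (by simp only; omega)
      rcases Nat.eq_zero_or_pos m with hm0 | hmpos
      · left; apply hsvr l hl; rw [hfl, hfcF, hm0]; exact Prod.ext rfl (by simp only; omega)
      rcases Nat.lt_or_ge M₀ m with hmgt | hmle
      swap
      · right; left; exact ⟨m, hmpos, hmle, hupidx l hl m hmpos hmle hfl⟩
      rcases Nat.lt_or_ge m (M₀ + 2) with hmq | hmq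
      · right; right; left
        have hmq' : m = M₀ + 1 := by omega
        exact hqidx l hl (by rw [hfl, hmq']; exact Prod.ext rfl (by simp only; push_cast; omega))
      rcases Nat.lt_or_ge m Mc with hmMc | hmMc
      · right; right; right; left; exact ⟨m, hmq, by omega, hfl⟩
      · right; right; right; right
        have hmMc' : m = Mc := by omega
        apply hsvE l hl; rw [hfl, hfcE, hmMc']
    -- arcs in the lower straight cells are vertical
    have hvert : ∀ m : ℕ, M₀ + 2 ≤ m → m ≤ Mc - 1 → ∀ l < n, ω.2.fc l = (r.1, r.2 - m) →
        ω.2.sOut l = .N ∨ ω.2.sOut l = .S := by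
      intro m hm1 hm2 l hl hfl
      have hst := hcolSt m (by omega) (by omega) (by omega) l hl hfl
      obtain ⟨a, ha, hfa, hsa⟩ := hNc m (by omega) (by omega)
      have hal : a = l := by
        by_contra hne
        exact (ω.2.not_straight_of_two_arcs hl ha (Ne.symm hne) (hfa.trans hfl.symm)).1 (ω.2.sOut_of_straight hl hst)
      subst hal
      have hout := ω.2.sOut_of_straight ha hst
      rcases hsa with h' | h'
      · right; rw [hout, h']; rfl
      · left; exact h'
    ---- the last crossing of column `r.1`: the arc `ls > firstHitG` leaves the column eastwards
    obtain ⟨ls, hls1, hls2, hcls, hcls1, hafter⟩ := ω.2.exists_last_cross (i := ω.2.firstHitG + 1) (j := n - 1)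
      (by omega) (by omega) (x := r.1)
      (by rw [(ω.2.fc_succ_eq_of_sOut_W (i := ω.2.firstHitG) (by omega) hWout).1, hfcF]; simp only; omega)
      (by rw [hfcZ]; simp only; omega)
    have hlsn : ls < n := by omega
    have hlsE : ω.2.sOut ls = .E := ω.2.sOut_eq_E_of_fst_succ (by omega) (by rw [hcls1, hcls])
    have hls_cases : (ls = iq' ∧ ω.2.sOut iq' = .E) ∨ (ls = iE ∧ ω.2.sOut iE = .E) := by
      rcases hCcls ls hlsn hcls with h' | ⟨m, -, -, h'⟩ | (h' | h') | ⟨m, hm1, hm2, h'⟩ | h'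
      · exfalso; omega
      · exfalso; omega
      · exfalso; omega
      · exact Or.inl ⟨h', by rw [← h']; exact hlsE⟩
      · exfalso
        rcases hvert m hm1 hm2 ls hlsn h' with h'' | h'' <;> rw [hlsE] at h'' <;> exact absurd h'' (by decide)
      · exact Or.inr ⟨h', by rw [← h']; exact hlsE⟩
    ---- the crossing is not at `e`: then `e` is entered from `N`, the column read upwards from `e` ends with `q`'s second arc `h' → S`,
    ---- and the walk has no way to be on the side `h'` of the column just before it
    have hls_q : ls = iq' ∧ ω.2.sOut iq' = .E := by
      rcases hls_cases with h' | ⟨hle, hEe⟩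
      · exact h'
      exfalso
      have hinE : ω.2.sIn iE = .N := by
        rcases hNE with h' | h'
        · exact h'
        · rw [hEe] at h'; exact absurd h' (by decide)
      have hcellsUp : ∀ j : ℕ, 1 ≤ j → j ≤ Mc - M₀ - 2 → ∀ i < n,
          ω.2.fc i = ((ω.2.fc iE).1, (ω.2.fc iE).2 + j) → arcKind (ω.2.sIn i) (ω.2.sOut i) = .straight := by
        intro j hj1 hj2 i hi hfi
        rw [hfcE] at hfi
        exact hcolSt (Mc - j) (by omega) (by omega) (by omega) i hi (by rw [hfi]; exact Prod.ext rfl (by simp only; omega))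
      have hNL : Mc - M₀ - 2 ≤ iE := by
        by_contra hlt
        push Not at hlt
        obtain ⟨-, hin0⟩ := ω.2.run_back_above_of_straight hiE le_rfl hinE
          (fun j hj1 hj2 i hi hfi => hcellsUp j hj1 (by omega) i hi hfi) iE le_rfl
        rw [Nat.sub_self, h0W] at hin0; exact absurd hin0 (by decide)
      have hrunUp := ω.2.run_back_above_of_straight hiE hNL hinE hcellsUp
      obtain ⟨hfcu, hinu⟩ := hrunUp (Mc - M₀ - 2) le_rfl
      rw [hfcE] at hfcu
      have h1u : 1 ≤ iE - (Mc - M₀ - 2) := by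
        by_contra hlt
        have e0 : iE - (Mc - M₀ - 2) = 0 := by omega
        rw [e0, h0W] at hinu; exact absurd hinu (by decide)
      obtain ⟨hfcq2, houtq2⟩ := fc_sOut_pred_of_sIn_N ω.2 (i := iE - (Mc - M₀ - 2)) (by omega) h1u hinu
      rw [hfcu] at hfcq2
      have hfcq2' : ω.2.fc (iE - (Mc - M₀ - 2) - 1) = (r.1, w.2) := by
        rw [hfcq2]; exact Prod.ext rfl (by simp only; omega)
      have hq2 : iE - (Mc - M₀ - 2) - 1 = iq' := by
        rcases hqidx _ (by omega) hfcq2' with h' | h'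
        · exfalso; rw [h', hNq] at houtq2; exact absurd houtq2 (by decide)
        · exact h'
      rw [hq2] at houtq2
      have hlowidx : ∀ l < n, ∀ m : ℕ, M₀ + 2 ≤ m → m ≤ Mc - 1 → ω.2.fc l = (r.1, r.2 - m) → l = iE - (Mc - m) := by
        intro l hl m hm1 hm2 hfl
        obtain ⟨hfcm, -⟩ := hrunUp (Mc - m) (by omega)
        rw [hfcE] at hfcm
        have hfcm' : ω.2.fc (iE - (Mc - m)) = (r.1, r.2 - m) := by rw [hfcm]; exact Prod.ext rfl (by simp only; omega)
        by_contra hne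
        have := (ω.2.not_straight_of_two_arcs (show iE - (Mc - m) < n by omega) hl (Ne.symm hne) (hfl.trans hfcm'.symm)).1
        exact this (ω.2.sOut_of_straight (by omega) (hcolSt m (by omega) (by omega) (by omega) _ (by omega) hfcm'))
      have hiq'F : ω.2.firstHitG < iq' := by
        by_contra hge
        push Not at hge
        obtain ⟨j, hj, hjle⟩ : ∃ j : ℕ, ω.2.firstHitG = iE - j ∧ j ≤ Mc - M₀ - 1 := ⟨iE - ω.2.firstHitG, by omega, by omega⟩
        rcases Nat.eq_zero_or_pos j with hj0 | hjpos
        · have e1 : ω.2.fc ω.2.firstHitG = (r.1, r.2 - Mc) := by rw [hj, hj0, Nat.sub_zero, hfcE]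
          rw [hfcF] at e1
          have := congrArg Prod.snd e1; simp only at this; omega
        rcases Nat.lt_or_ge j (Mc - M₀ - 1) with hjlt | hjge
        · obtain ⟨hfcj, -⟩ := hrunUp j (by omega)
          rw [hfcE, ← hj, hfcF] at hfcj
          have := congrArg Prod.snd hfcj; simp only at this; omega
        · have hjq : ω.2.firstHitG = iq' := by omega
          have e1 : ω.2.fc ω.2.firstHitG = (r.1, w.2) := by rw [hjq, hfcq']
          rw [hfcF] at e1
          have := congrArg Prod.snd e1; simp only at this; omega
      have hCidx : ∀ l < n, (ω.2.fc l).1 = r.1 → (iq ≤ l ∧ l ≤ ω.2.firstHitG) ∨ (iq' ≤ l ∧ l ≤ iE) := by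
        intro l hl hcol1
        rcases hCcls l hl hcol1 with h' | ⟨m, hm1, hm2, h'⟩ | (h' | h') | ⟨m, hm1, hm2, h'⟩ | h'
        · left; omega
        · left; omega
        · left; omega
        · right; omega
        · right; have := hlowidx l hl m hm1 hm2 h'; omega
        · right; omega
      rcases hinq with hWin | hEin
      · -- `iq'` is `E → S`: just before it the walk is east of the column, just after the first hit west of it
        have hEq' : ω.2.sIn iq' = .E := by
          have hne := ω.2.sIn_ne_sOut hiq'n
          rw [houtq2] at hne
          rw [hWin] at d1
          revert d1 d2 hne; cases ω.2.sIn iq' <;> decide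
        obtain ⟨hfcp, -⟩ := ω.2.fc_pred_eq_of_sIn_E hiq'n (by omega) hEq'
        rw [hfcq'] at hfcp
        have hij : ω.2.firstHitG + 1 ≤ iq' - 1 := by
          by_contra hlt
          have hqe : iq' - 1 = ω.2.firstHitG := by omega
          rw [hqe, hfcF] at hfcp
          have := congrArg Prod.snd hfcp; simp only at this; omega
        obtain ⟨l, hl1, hl2, hl3⟩ := ω.2.exists_fst_eq_between (i := ω.2.firstHitG + 1) (j := iq' - 1) hij (by omega) (x := r.1)
          (by rw [(ω.2.fc_succ_eq_of_sOut_W (i := ω.2.firstHitG) (by omega) hWout).1, hfcF]; simp only; omega)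
          (by rw [hfcp]; simp only; omega)
        rcases hCidx l (by omega) hl3 with h' | h' <;> omega
      · -- `iq` is `E → N`, before the first hit: just before it the walk is east of the column, at the start west of it
        have hiq1 : 1 ≤ iq := by
          by_contra hlt
          have e0 : iq = 0 := by omega
          rw [e0, h0W] at hEin; exact absurd hEin (by decide)
        obtain ⟨hfcp, -⟩ := ω.2.fc_pred_eq_of_sIn_E hiqn hiq1 hEin
        rw [hfcq] at hfcp
        obtain ⟨l, -, hl2, hl3⟩ := ω.2.exists_fst_eq_between (i := 0) (j := iq - 1) (by omega) (by omega) (x := r.1)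
          (by rw [h0w]; omega) (by rw [hfcp]; simp only; omega)
        rcases hCidx l (by omega) hl3 with h' | h' <;> omega
    obtain ⟨hls_eq, hEq'⟩ := hls_q
    ---- so the crossing is `q`'s second arc `S → E`, after the first hit; below it the column reads downwards back to `e`, left through `N`
    have hSq'' : ω.2.sIn iq' = .S := by
      rcases hSq' with h' | h'
      · exact h'
      · rw [hEq'] at h'; exact absurd h' (by decide)
    have hWin : ω.2.sIn iq = .W := by
      rcases hinq with h' | h'
      · exact h'
      · exfalso; rw [h', hEq'] at d3; exact d3 rfl
    have hcellsDn : ∀ j : ℕ, 1 ≤ j → j ≤ Mc - M₀ - 2 → ∀ i < n,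
        ω.2.fc i = ((ω.2.fc iq').1, (ω.2.fc iq').2 - j) → arcKind (ω.2.sIn i) (ω.2.sOut i) = .straight := by
      intro j hj1 hj2 i hi hfi
      rw [hfcq'] at hfi
      exact hcolSt (M₀ + 1 + j) (by omega) (by omega) (by omega) i hi (by rw [hfi]; exact Prod.ext rfl (by simp only; push_cast; omega))
    have hNL : Mc - M₀ - 2 ≤ iq' := by
      by_contra hlt
      push Not at hlt
      obtain ⟨-, hin0⟩ := ω.2.run_back_below_of_straight hiq'n le_rfl hSq''
        (fun j hj1 hj2 i hi hfi => hcellsDn j hj1 (by omega) i hi hfi) iq' le_rfl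
      rw [Nat.sub_self, h0W] at hin0; exact absurd hin0 (by decide)
    have hrunDn := ω.2.run_back_below_of_straight hiq'n hNL hSq'' hcellsDn
    obtain ⟨hfcd, hind⟩ := hrunDn (Mc - M₀ - 2) le_rfl
    rw [hfcq'] at hfcd
    have h1d : 1 ≤ iq' - (Mc - M₀ - 2) := by
      by_contra hlt
      have e0 : iq' - (Mc - M₀ - 2) = 0 := by omega
      rw [e0, h0W] at hind; exact absurd hind (by decide)
    obtain ⟨hfce2, houte2⟩ := fc_sOut_pred_of_sIn_S ω.2 (i := iq' - (Mc - M₀ - 2)) (by omega) h1d hind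
    rw [hfcd] at hfce2
    have hfce2' : ω.2.fc (iq' - (Mc - M₀ - 2) - 1) = (r.1, r.2 - Mc) := by
      rw [hfce2]; exact Prod.ext rfl (by simp only; omega)
    have he2 : iq' - (Mc - M₀ - 2) - 1 = iE := hsvE _ (by omega) (hfce2'.trans hfcE.symm)
    rw [he2] at houte2
    have hinEW : ω.2.sIn iE = .W ∨ ω.2.sIn iE = .E := by
      have hne := ω.2.sIn_ne_sOut hiE
      rw [houte2] at hne
      revert hninE hne; cases ω.2.sIn iE <;> decide
    have hlowidx : ∀ l < n, ∀ m : ℕ, M₀ + 2 ≤ m → m ≤ Mc - 1 → ω.2.fc l = (r.1, r.2 - m) → l = iq' - (m - M₀ - 1) := by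
      intro l hl m hm1 hm2 hfl
      obtain ⟨hfcm, -⟩ := hrunDn (m - M₀ - 1) (by omega)
      rw [hfcq'] at hfcm
      have hfcm' : ω.2.fc (iq' - (m - M₀ - 1)) = (r.1, r.2 - m) := by
        rw [hfcm]; exact Prod.ext rfl (by simp only; omega)
      by_contra hne
      have := (ω.2.not_straight_of_two_arcs (show iq' - (m - M₀ - 1) < n by omega) hl (Ne.symm hne) (hfl.trans hfcm'.symm)).1
      exact this (ω.2.sOut_of_straight (by omega) (hcolSt m (by omega) (by omega) (by omega) _ (by omega) hfcm'))
    have hiEF : ω.2.firstHitG < iE := by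
      by_contra hge
      push Not at hge
      obtain ⟨j, hj, hjle⟩ : ∃ j : ℕ, ω.2.firstHitG = iq' - j ∧ j ≤ Mc - M₀ - 1 := ⟨iq' - ω.2.firstHitG, by omega, by omega⟩
      rcases Nat.eq_zero_or_pos j with hj0 | hjpos
      · have e1 : ω.2.fc ω.2.firstHitG = (r.1, w.2) := by rw [hj, hj0, Nat.sub_zero, hfcq']
        rw [hfcF] at e1
        have := congrArg Prod.snd e1; simp only at this; omega
      rcases Nat.lt_or_ge j (Mc - M₀ - 1) with hjlt | hjge
      · obtain ⟨hfcj, -⟩ := hrunDn j (by omega)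
        rw [hfcq', ← hj, hfcF] at hfcj
        have := congrArg Prod.snd hfcj; simp only at this; omega
      · have hje : ω.2.firstHitG = iE := by omega
        have e1 : ω.2.fc ω.2.firstHitG = (r.1, r.2 - Mc) := by rw [hje, hfcE]
        rw [hfcF] at e1
        have := congrArg Prod.snd e1; simp only at this; omega
    have hCidx : ∀ l < n, (ω.2.fc l).1 = r.1 → (iq ≤ l ∧ l ≤ ω.2.firstHitG) ∨ (iE ≤ l ∧ l ≤ iq') := by
      intro l hl hcol1
      rcases hCcls l hl hcol1 with h' | ⟨m, hm1, hm2, h'⟩ | (h' | h') | ⟨m, hm1, hm2, h'⟩ | h'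
      · left; omega
      · left; omega
      · left; omega
      · right; omega
      · right; have := hlowidx l hl m hm1 hm2 h'; omega
      · right; omega
    -- `e` is entered from `W`
    have hinEWest : ω.2.sIn iE = .W := by
      rcases hinEW with h' | hEin
      · exact h'
      exfalso
      obtain ⟨hfcp, -⟩ := ω.2.fc_pred_eq_of_sIn_E hiE (by omega) hEin
      rw [hfcE] at hfcp
      have hij : ω.2.firstHitG + 1 ≤ iE - 1 := by
        by_contra hlt
        have hqe : iE - 1 = ω.2.firstHitG := by omega
        rw [hqe, hfcF] at hfcp
        have := congrArg Prod.snd hfcp; simp only at this; omega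
      obtain ⟨l, hl1, hl2, hl3⟩ := ω.2.exists_fst_eq_between (i := ω.2.firstHitG + 1) (j := iE - 1) hij (by omega) (x := r.1)
        (by rw [(ω.2.fc_succ_eq_of_sOut_W (i := ω.2.firstHitG) (by omega) hWout).1, hfcF]; simp only; omega)
        (by rw [hfcp]; simp only; omega)
      rcases hCidx l (by omega) hl3 with h' | h' <;> omega
    -- before `iq'` the walk is never strictly east of the column
    have hbefore : ∀ l < n, r.1 < (ω.2.fc l).1 → iq' < l := by
      intro l hl hgt
      by_contra hle
      push Not at hle
      have hne : (ω.2.fc l).1 ≠ r.1 := by omega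
      rcases Nat.lt_or_ge l iq with hlq | hlq
      · obtain ⟨l', -, hl'2, hl'3⟩ := ω.2.exists_fst_eq_between (i := 0) (j := l) (by omega) hl (x := r.1)
          (by rw [h0w]; omega) hgt.le
        rcases hCidx l' (by omega) hl'3 with h' | h' <;> omega
      rcases Nat.lt_or_ge ω.2.firstHitG l with hlf | hlf
      · rcases Nat.lt_or_ge l iE with hle' | hle'
        · obtain ⟨l', hl'1, hl'2, hl'3⟩ := ω.2.exists_fst_eq_between (i := ω.2.firstHitG + 1) (j := l) (by omega) hl (x := r.1)
            (by rw [(ω.2.fc_succ_eq_of_sOut_W (i := ω.2.firstHitG) (by omega) hWout).1, hfcF]; simp only; omega) hgt.le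
          rcases hCidx l' (by omega) hl'3 with h' | h' <;> omega
        · obtain ⟨j, hj⟩ : ∃ j : ℕ, l = iq' - j ∧ j ≤ Mc - M₀ - 1 := ⟨iq' - l, by omega, by omega⟩
          rcases Nat.lt_or_ge j (Mc - M₀ - 1) with hjlt | hjge
          · obtain ⟨hfcj, -⟩ := hrunDn j (by omega)
            rw [hfcq', ← hj.1] at hfcj
            apply hne; rw [hfcj]
          · have : l = iE := by omega
            apply hne; rw [this, hfcE]
      · obtain ⟨j, hj⟩ : ∃ j : ℕ, l = ω.2.firstHitG - j ∧ j ≤ M₀ + 1 := ⟨ω.2.firstHitG - l, by omega, by omega⟩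
        rcases Nat.lt_or_ge j (M₀ + 1) with hjlt | hjge
        · obtain ⟨hfcj, -⟩ := hrunS j (by omega)
          rw [hfcF, ← hj.1] at hfcj
          apply hne; rw [hfcj]
        · have : l = iq := by omega
          apply hne; rw [this, hfcq]
    ---- `e` is an exit turn of the bottom row entered from `W`: it is `b₁` or an outsider; a bottom arc after `e` makes it an outsider
    have he_b₀ : (((r.1 : ℤ), r.2 - Mc) : Face) ≠ ω.2.fc j₀ := by
      intro e
      have := hsvE j₀ hj₀ (e.symm.trans hfcE.symm)
      rw [this, hinEWest] at hN₀'
      exact absurd hN₀' (by decide)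
    have he_out : (((r.1 : ℤ), r.2 - Mc) : Face) ≠ ω.2.fc j₁ →
        (((r.1 : ℤ), r.2 - Mc) : Face) ≠ ((r.1 : ℤ) - M, r.2) ∧ (((r.1 : ℤ), r.2 - Mc) : Face) ≠ r ∧
          (((r.1 : ℤ), r.2 - Mc) : Face) ≠ ω.2.fc j₀ ∧ (((r.1 : ℤ), r.2 - Mc) : Face) ≠ ω.2.fc j₁ ∧
          (((r.1 : ℤ), r.2 - Mc) : Face) ≠ ((τ1 : ℤ), w.2) := fun hne =>
      ⟨hne_of_row _ _ (by simp only; omega), hne_of_row _ _ (by simp only; omega), he_b₀, hne, hne_of_row _ _ (by simp only; omega)⟩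
    have hlate : ∀ a < n, (ω.2.fc a).2 = Y' → iE < a → (((r.1 : ℤ), r.2 - Mc) : Face) ≠ ω.2.fc j₁ := by
      intro a ha hrow hlt e
      have := hsvE j₁ hj₁ (e.symm.trans hfcE.symm)
      exact hmax₁ a (by omega) ha hrow
    ---- from `q` the walk runs east along the root row into `τ`: the cells in between are straight
    have hrowStE : ∀ m : ℕ, 1 ≤ m → (m : ℤ) < τ1 - r.1 → ∀ i < n, ω.2.fc i = (r.1 + m, w.2) →
        arcKind (ω.2.sIn i) (ω.2.sOut i) = .straight := by
      intro m hm1 hm2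
      have hcW : ω.2.UsesSide (r.1 + m, w.2) .W := by
        have := hτWs ((r.1 - (w.1 + k)).toNat + m) (by omega) (by push_cast; omega)
        rwa [show (w.1 : ℤ) + k + (((r.1 - (w.1 + k)).toNat + m : ℕ) : ℤ) = r.1 + m by push_cast; omega] at this
      have hcE : ω.2.UsesSide (r.1 + m, w.2) .E := by
        have := hτEs ((r.1 - (w.1 + k)).toNat + m) (by push_cast; omega)
        rwa [show (w.1 : ℤ) + k + (((r.1 - (w.1 + k)).toNat + m : ℕ) : ℤ) = r.1 + m by push_cast; omega] at this
      refine ω.2.straight_of_usesSide_EW (s := .N) hcE hcW ?_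
      intro hcN
      obtain ⟨Mv, hMv1, hMvrow, hPξ, -, -, -, hξUses, -⟩ := hNend _ _ hcN
      have hξtop := hNtop_of _ _ _ hPξ le_rfl hMvrow hξUses hMv1
      rw [hξtop] at hPξ
      obtain ⟨o1, o2, o3, o4, o5⟩ := hout_top (((r.1 : ℤ) + m, r.2) : Face) rfl (by simp only; omega)
      -- the kiss uses `S`; its `S`-chain ends on the bottom row, late
      have hcS : ω.2.UsesSide (r.1 + m, w.2) .S := by
        by_contra hnS
        obtain ⟨a, ha, hfa, hsa⟩ := hcN
        obtain ⟨b, hb, hfb, hsb⟩ := hcW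
        obtain ⟨c, hc', hfc', hsc⟩ := hcE
        have eab := ω.2.single_visit_of_not_usesSide hnS ha hb hfa hfb
        have eac := ω.2.single_visit_of_not_usesSide hnS ha hc' hfa hfc'
        subst eab; subst eac
        have hne := ω.2.sIn_ne_sOut ha
        revert hsa hsb hsc hne; cases ω.2.sIn a <;> cases ω.2.sOut a <;> decide
      obtain ⟨Mu, hMu1, hMurow, hPη, -, -, -, hηUses, iη, hiη, hfcη, -, -, -⟩ := hSend _ _ hcS
      have hηbot := hSbot_of _ _ _ hPη le_rfl hMurow hηUses hMu1
      have hiηlate : iq' < iη := hbefore iη hiη (by rw [hfcη]; simp only; omega)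
      have heb₁ := hlate iη hiη (by rw [hfcη]; simp only; exact hηbot) (by omega)
      obtain ⟨e1, e2, e3, e4, e5⟩ := he_out heb₁
      exact houts _ _ hPξ hPe (hne_of_row _ _ (by simp only; omega)) o1 o2 o3 o4 o5 e1 e2 e3 e4 e5
    ---- the arc into the column before the first hit enters `p₁` from `W`: it is the first turn
    have hiqk : iq = k := by
      obtain ⟨hin1, -⟩ := ω.2.side_sIn_eq_nth hiqn
      obtain ⟨hin2, -⟩ := ω.2.side_sIn_eq_nth hk₁
      rw [hfcq, hWin] at hin1
      rw [hfk, hWk, ← hrk] at hin2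
      exact ω.2.nth_inj (by omega) (by omega) (hin1.symm.trans hin2)
    have hkN : ω.2.sOut k = .N := by rw [← hiqk]; exact hNq
    -- no plaquette strictly between `p₁` and `τ` uses `N`
    have hnoN : ∀ m : ℕ, 1 ≤ m → (m : ℤ) < τ1 - r.1 → ¬ω.2.UsesSide (r.1 + m, w.2) .N := by
      intro m hm1 hm2 hN
      obtain ⟨a, ha, hfa, hsa⟩ := hN
      have hst := hrowStE m hm1 hm2 a ha hfa
      have hcW : ω.2.UsesSide (r.1 + m, w.2) .W := by
        have := hτWs ((r.1 - (w.1 + k)).toNat + m) (by omega) (by push_cast; omega)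
        rwa [show (w.1 : ℤ) + k + (((r.1 - (w.1 + k)).toNat + m : ℕ) : ℤ) = r.1 + m by push_cast; omega] at this
      obtain ⟨b, hb, hfb, hsb⟩ := hcW
      have hout := ω.2.sOut_of_straight ha hst
      rcases eq_or_ne b a with hba | hba
      · subst hba
        have hne := ω.2.sIn_ne_sOut ha
        revert hsa hsb hout hne; cases ω.2.sIn b <;> cases ω.2.sOut b <;> decide
      · exact (ω.2.not_straight_of_two_arcs ha hb (Ne.symm hba) (hfb.trans hfa.symm)).1 hout
    refine ⟨hWk, hkN, by omega, fun i hi hik => ?_, fun i j hi hj hfij hij => ?_⟩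
    · rcases Nat.lt_or_ge i k with hlt | hge
      · exact hstrk i hlt
      · obtain ⟨hfcm, -⟩ := hrunS (ω.2.firstHitG - i) (by omega)
        rw [show ω.2.firstHitG - (ω.2.firstHitG - i) = i by omega] at hfcm
        exact hcellsS (ω.2.firstHitG - i) (by omega) (by omega) i (by omega) hfcm
    · obtain ⟨hroww, hcol1⟩ := hkiss_pre i j hi hj hfij hij
      have hall : ∀ s, ω.2.UsesSide ((ω.2.fc i).1, (ω.2.fc i).2) s := fun s => ω.2.usesSide_of_fc_eq hi hj hij hfij s
      rcases lt_or_eq_of_le hcol1 with heast | heq1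
      · exfalso
        rcases hkiss_east i j hi hj hfij hij heast with ⟨g, hPg, hg2, hg1, hg1', hgW, a1, a2, a3, a4, a5⟩ | ⟨-, hEw, hWw⟩
        · -- the east chain of the kiss ends at `τ` — but then the outsider `g` lies between `p₁` and `τ` without using `W` — or at a second outsider
          obtain ⟨M₂, hM₂, hP₂, -, -, hnot₂⟩ := hEend _ _ (hall .E)
          rw [hroww] at hP₂ hnot₂
          by_cases hτe : (ω.2.fc i).1 + (M₂ : ℤ) = τ1
          · apply hgW
            have := hτWs (g.1 - (w.1 + k)).toNat (by omega) (by omega)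
            have e : (((w.1 : ℤ) + k + ((g.1 - (w.1 + k)).toNat : ℕ), w.2) : Face) = g :=
              Prod.ext (by simp only; omega) (by simp only; omega)
            rwa [e] at this
          · exact houts _ _ hPg hP₂ (fun e => by have := congrArg Prod.fst e; simp only at this; omega) a1 a2 a3 a4 a5
              (hne_of_row _ _ (by simp only; omega)) (hne_of_row _ _ (by simp only; omega))
              (hne_of_row _ _ (by rw [hrow₀']; simp only; omega)) (hne_of_row _ _ (by rw [hrow₁']; simp only; omega))
              (fun e => hτe (by have := congrArg Prod.fst e; simpa using this))
        · -- the west chain reaches `w`: the kiss lies strictly between `p₁` and `τ` and uses `N`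
          have hflt : (ω.2.fc i).1 < τ1 := by
            by_contra hge
            push Not at hge
            apply hτnE
            rcases lt_or_eq_of_le hge with hlt' | heq'
            · have := hEw ((ω.2.fc i).1 - τ1).toNat (by omega) (by omega)
              have e : (((ω.2.fc i).1 - (((ω.2.fc i).1 - τ1).toNat : ℕ), w.2) : Face) = ((τ1 : ℤ), w.2) :=
                Prod.ext (by simp only; omega) rfl
              rwa [e] at this
            · have := hall .E
              have e : (((ω.2.fc i).1, (ω.2.fc i).2) : Face) = ((τ1 : ℤ), w.2) := Prod.ext (by simp only; omega) (by simp only; omega)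
              rwa [e] at this
          refine hnoN ((ω.2.fc i).1 - r.1).toNat (by omega) (by omega) ?_
          have := hall .N
          have e : (((ω.2.fc i).1, (ω.2.fc i).2) : Face) = ((r.1 : ℤ) + (((ω.2.fc i).1 - r.1).toNat : ℕ), w.2) :=
            Prod.ext (by simp only; omega) (by simp only; omega)
          rwa [e] at this
      · -- the kiss is `p₁`: its arcs are the first turn `k` and `iq'`
        have hfi : ω.2.fc i = (r.1, w.2) := Prod.ext heq1.symm hroww
        have hfj : ω.2.fc j = (r.1, w.2) := hfij.symm.trans hfi
        refine ⟨by rw [hfi, hrk], ?_⟩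
        rcases hqidx i hi hfi with hi' | hi' <;> rcases hqidx j hj hfj with hj' | hj'
        · exact absurd (hi'.trans hj'.symm) hij
        · left; rw [hi', hj', hiqk]; exact ⟨hWk, hkN, hSq'', hEq'⟩
        · right; rw [hi', hj', hiqk]; exact ⟨hSq'', hEq', hWk, hkN⟩
        · exact absurd (hi'.trans hj'.symm) hij

end ΩG

end Literature.Probability.RandomPlanarGeometry.SAW.YangBaxter
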